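/-
Copyright (c) 2026. All rights reserved.
Released under Apache 2.0 license as described in the file LICENSE.
Authors: abc-iut cell, prover seat abc-iut-L4-t8 (gen 12; cell row «LTIMES-SUM-CARRIER», L4-lead m184), over abc-iut-L4-t3's
`toLtimes` restriction (`Ltimes/LogFrobeniusRestrict.lean`) and `⋉`-twinned add-ons, and abc-iut-f-101's genuine open carrier.
-/
import Literature.AnabelianGeometry.AbsoluteAnabelian.Ltimes.LogFrobeniusRestrict
import Literature.AnabelianGeometry.AbsoluteAnabelian.Ltimes.LogFrobeniusMonoTelecoreCoherence
import Literature.AnabelianGeometry.AbsoluteAnabelian.Ltimes.LogFrobeniusIotaAnMono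
import Literature.AnabelianGeometry.AbsoluteAnabelian.LogFrobeniusMonoTelecoreGenuineOpen
import Literature.AnabelianGeometry.AbsoluteAnabelian.LogFrobeniusIotaAnMono
import HarnessLib

/-!
# [AbsTopIII] Cor 5.10: the add-ons of a frozen carrier RESTRICT along `toLtimes` — the genuine open carrier over `⋉`

S. Mochizuki, *Topics in absolute anabelian geometry III*, J. Math. Sci. Univ. Tokyo 22 (2015) [MochizukiAbsTopIII2015]; manuscript
`paper:url-5493eb38cbb7`, read on the page: Cor 5.10 preamble p. 146 (mono-analyticization homotopies), Cor 5.10 (iv)(c) p. 148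
(`η⊢_{v,ν}`, `ψ^{An⊢⊞}_{w,ν}` over `ℰ⊢`), Prop 5.8 (vii) p. 141, Def 5.4 (vii) p. 128 / Cor 5.5 (iii) p. 131 (`ι⊞` on `Γ⃗^⋉_v`).

abc-iut-L4-t3's `LogFrobeniusSetting.toLtimes` (S1b) forgets `ι⊞` along `k^× ↪ k` and keeps every other field ON THE NOSE; the add-ons
`MonoAnalyticizationHomotopies`, `MonoTelecoreCoherence`, `IotaAnMono` do not mention `ι⊞`, so a frozen carrier's add-ons ARE add-ons of
its restriction, field by field (`rfl`).  This file records the three transfers and instantiates them at abc-iut-f-101's genuine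
open-augmentation carrier `genuineOpen p V`: `(genuineOpen p V).toLtimes` carries abc-iut-L4-t3's add-on `MonoTelecoreCoherence` over `⋉`
(★ `monoTelecoreCoherence_openLtimes`) — the nonarchimedean summand of the two-sided `⋉`-carrier (cell row «LTIMES-SUM-CARRIER»).
OUR kernel bookkeeping over a successor of OUR typing; nothing here bears on [IUTchIII] Cor. 3.12; no side taken; typed ≠ proved.
-/

set_option autoImplicit false

noncomputable section

universe u

open CategoryTheory

namespace Literature.AnabelianGeometry.AbsoluteAnabelian

namespace LogFrobeniusSetting

variable {Vmod : Type u} {isArc : Vmod → Bool} (L : LogFrobeniusSetting Vmod isArc)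

/-- **mono-analyticization homotopies restrict along `toLtimes`** (rows 4 → 5 and 6 → 7 are untouched by the restriction).
[cite: MochizukiAbsTopIII2015, Cor 5.10 p. 146] -/
def MonoAnalyticizationHomotopies.toLtimes (M : L.MonoAnalyticizationHomotopies) :
    L.toLtimes.MonoAnalyticizationHomotopies where
  toE := M.toE
  anToE := M.anToE

/-- the rows-4→5 homotopy of the restriction is the original one. [cite: MochizukiAbsTopIII2015, Cor 5.10 p. 146] -/
@[simp] theorem MonoAnalyticizationHomotopies.toLtimes_toE (M : L.MonoAnalyticizationHomotopies) (v : Vmod) :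
    (MonoAnalyticizationHomotopies.toLtimes L M).toE v = M.toE v := rfl

/-- the rows-6→7 homotopy of the restriction is the original one. [cite: MochizukiAbsTopIII2015, Cor 5.10 p. 146] -/
@[simp] theorem MonoAnalyticizationHomotopies.toLtimes_anToE (M : L.MonoAnalyticizationHomotopies) :
    (MonoAnalyticizationHomotopies.toLtimes L M).anToE = M.anToE := rfl

/-- **abc-iut-L4-t3's add-on (c)+(d)+coherence restricts along `toLtimes`**: `ψ` over `ℰ⊢`, `η⊢_{v,ν}` and its coherence are untouched
(none of them mentions `ι⊞`). [cite: MochizukiAbsTopIII2015, Cor 5.10 (iv)(c) p. 148] -/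
def MonoTelecoreCoherence.toLtimes {M : L.MonoAnalyticizationHomotopies} (K : L.MonoTelecoreCoherence M) :
    L.toLtimes.MonoTelecoreCoherence (MonoAnalyticizationHomotopies.toLtimes L M) where
  psiOver := K.psiOver
  eta := K.eta
  eta_over := K.eta_over

/-- `ψ` over `ℰ⊢` of the restriction is the original one. [cite: MochizukiAbsTopIII2015, Prop 5.8 (vii) p. 141] -/
@[simp] theorem MonoTelecoreCoherence.toLtimes_psiOver {M : L.MonoAnalyticizationHomotopies} (K : L.MonoTelecoreCoherence M)
    (w : Vmod) (j : {ν : LogVertex (isArc w) // ν.IsCross}) :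
    (MonoTelecoreCoherence.toLtimes L K).psiOver w j = K.psiOver w j := rfl

/-- `η⊢_{v,ν}` of the restriction is the original one. [cite: MochizukiAbsTopIII2015, Cor 5.10 (iv)(c) p. 148] -/
@[simp] theorem MonoTelecoreCoherence.toLtimes_eta {M : L.MonoAnalyticizationHomotopies} (K : L.MonoTelecoreCoherence M)
    (v : Vmod) (ν : LogVertex (isArc v)) (hν : ν.IsCross) :
    (MonoTelecoreCoherence.toLtimes L K).eta v ν hν = K.eta v ν hν := rfl

/-- **`ι^{An⊢⊞}` restricts along `toLtimes`** (it is indexed by the `TS`-edges of `Γ⃗×_w`, not by `ι⊞`).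
[cite: MochizukiAbsTopIII2015, Cor 5.5 (iii) p. 131] -/
def IotaAnMono.toLtimes {hψ : ∀ (w : Vmod) (j : {ν : LogVertex (isArc w) // ν.IsCross}),
      L.ψAnMono w j ⋙ L.forgetMono w ⋙ L.toEmono w ≅ L.κAnMono.inverse} (I : L.IotaAnMono hψ) :
    L.toLtimes.IotaAnMono hψ where
  ι := I.ι
  ι_over := I.ι_over

/-- `ι^{An⊢⊞}` of the restriction is the original one. [cite: MochizukiAbsTopIII2015, Cor 5.5 (iii) p. 131] -/
@[simp] theorem IotaAnMono.toLtimes_ι {hψ : ∀ (w : Vmod) (j : {ν : LogVertex (isArc w) // ν.IsCross}),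
      L.ψAnMono w j ⋙ L.forgetMono w ⋙ L.toEmono w ≅ L.κAnMono.inverse} (I : L.IotaAnMono hψ)
    (w : Vmod) {ν₁ ν₂ : LogVertex (isArc w)} (ε : LogEdgeTS (isArc w) ν₁ ν₂) (hε : ε.InCore) :
    (IotaAnMono.toLtimes L I).ι w ε hε = I.ι w ε hε := rfl

/-! ## The genuine open-augmentation carrier over `⋉` -/

section Open

variable (p : ℕ) [Fact p.Prime] (Vmod : Type 1)

/-- the mono-analyticization homotopies of `(genuineOpen p V).toLtimes` (abc-iut-f-101's, restricted).
[cite: MochizukiAbsTopIII2015, Cor 5.10 p. 146] -/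
def monoAnalyticizationHomotopies_openLtimes : (genuineOpen p Vmod).toLtimes.MonoAnalyticizationHomotopies :=
  MonoAnalyticizationHomotopies.toLtimes _ (monoAnalyticizationHomotopies_open p Vmod)

/-- ★ **abc-iut-L4-t3's add-on `MonoTelecoreCoherence` over `⋉` at the genuine open-augmentation carrier** `(genuineOpen p V).toLtimes`
(abc-iut-f-101's `monoTelecoreCoherence_open`, restricted) — the nonarchimedean summand of the two-sided `⋉`-carrier.
[cite: MochizukiAbsTopIII2015, Cor 5.10 (iv)(c) p. 148] -/
def monoTelecoreCoherence_openLtimes :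
    (genuineOpen p Vmod).toLtimes.MonoTelecoreCoherence (monoAnalyticizationHomotopies_openLtimes p Vmod) :=
  MonoTelecoreCoherence.toLtimes _ (monoTelecoreCoherence_open p Vmod)

/-- [AbsTopIII] Cor 5.10 (iv)(a) over `⋉` at `(genuineOpen p V).toLtimes` for `V ≠ ∅` (abc-iut-L4-t3's `cor510MonoCores_holds` over the
successor, fed with the restricted add-on). [cite: MochizukiAbsTopIII2015, Cor 5.10 (iv)(a) p. 147] -/
theorem cor510MonoCores_openLtimes [Nonempty Vmod] : (genuineOpen p Vmod).toLtimes.Cor510MonoCores :=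
  LogFrobeniusSettingLtimes.cor510MonoCores_holds (monoAnalyticizationHomotopies_openLtimes p Vmod)

/-- the restricted add-on is inhabited (existence form). [cite: MochizukiAbsTopIII2015, Cor 5.10 (iv)(c) p. 148] -/
theorem nonempty_monoTelecoreCoherence_openLtimes :
    Nonempty ((genuineOpen p Vmod).toLtimes.MonoTelecoreCoherence (monoAnalyticizationHomotopies_openLtimes p Vmod)) :=
  ⟨monoTelecoreCoherence_openLtimes p Vmod⟩

end Open

end LogFrobeniusSetting

end Literature.AnabelianGeometry.AbsoluteAnabelian

end
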